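import Literature.Probability.Percolation.LoopCrossingArms
import Literature.Probability.Percolation.SiteInterfaceReverse
import Literature.Probability.Percolation.CutPointAltArms
import Literature.Probability.Percolation.ArmSeparationGlue
import HarnessLib

/-!
# Three shell traversals by interface loops force four alternating arms (cluster form)

Topic: Probability / Percolation. Proof-only file serving the named fact
`Literature.Probability.Percolation.fourArm_exponent` (S. Smirnov, W. Werner, *Critical exponents
for two-dimensional percolation*, Math. Res. Lett. **8** (2001), Thm. 4 of arXiv `math/0109120`,
`j = 4`), through its remaining continuum input: the scaling limit (16) of the ALTERNATING four-arm
probabilities `P_{1/2}(altFourArm (ρr) (ρR))` (`AltFourArm.lean`; the hypothesis `hlim` of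
`fourArm_exponent_of_altLimits`, `ArmExponentsFourArmInputs.lean`, or the bounds `hup`/`hlow` of
`fourArm_exponent_of_eventualBounds_alt_crit`, `ArmExponentsFourArmAlt.lean`). As for two arms
(`ArmEventsInterface.lean` → `TwoArmScalingLimitFromLoops.lean`: "two arms ⇔ an interface loop
crosses the annulus", then portmanteau under the Camia–Newman loop limit
`exists_isCNLFamily_tendsto`), the lattice input of that limit is a dictionary between arm events
and crossings of the annulus by the interface loops of the configuration. This file proves the
direction that gives the LOWER bound (the `liminf` half of the portmanteau argument; Garban–Pete–
Schramm, J. Amer. Math. Soc. 26 (2013), §2.4, proof of the measurability lemma: "if there are at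
least 4 interfaces, then also `𝒜₄` holds"; Smirnov–Werner 2001, §4, Remark 6 and (15): for even
`j` the `j` crossings of the exploration process give `j` alternating arms):

**if the interface loops of `ω` (cycles of the hexagonal lattice with open sites on their left and
closed sites on their right, `IsSiteInterfaceLoop`, drawn at mesh `δ`) traverse a round shell
`{ρ ≤ |z| ≤ R}` at least three times in total — by separate segments of one loop, or of several
loops with pairwise distinct (hence disjoint) traces — then `ω ∈ altFourArm r₁ r₂`** for every
hexagonal annulus `{r₁ ≤ |·|_𝕋 ≤ r₂}` well inside the shell (`mem_altFourArm_of_hasTraversals`,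
`IsSiteInterfaceLoop.mem_altFourArm_of_hasTraversals_three`, `mem_altFourArm_of_hasTraversals_two`;
vertex-index form `mem_altFourArm_of_vertexTraversals`). Three traversals (not four) suffice
because a closed loop crossing an annulus geometrically twice is traversed, in the sense of
Aizenman–Burchard's separate segments in time, once or twice according to its base point.

## The argument

It is the sector argument of M. Aizenman, A. Burchard, Duke Math. J. 99 (1999), Appendix A, in the
form the tree already uses for the tightness of the loop ensemble (`LoopTraversalBound.lean`,
`LoopCrossingArms.lean`: traversals ⇒ strict crossing arcs ⇒ components of the open shell minus the
traces, at most two-to-one on the arcs by `not_three_arcs_touch` of `AnnulusArcs.lean` ⇒ disjoint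
open left chains), pushed to the alternating event in cluster form:

* `exists_two_left_chains_of_traversals` — for a finite family of interface loops with pairwise
  disjoint traces and `≥ 3` traversals in total (several per loop allowed, on separated time
  intervals from positive times), two of the traversals carry stretches of left (open) sites
  crossing `A(x; q₁ + 9δ, q₂ - 9δ)`, with `δ`-discs in the open shell `U`, such that no point of the
  second lies in the component, in `U` minus ALL the traces, of a point of the first;
  `exists_two_left_chains_of_vertices` — the same with traversals given by vertex indices of the
  polygons (`exists_time_near_polyPt`: every piece index is attained, `polyIdx_zero`,
  `polyIdx_one`, `exists_time_polyIdx_eq`), a form invariant under reversing the loops;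
* `PathIn.triMeshPoint_mem_connectedComponentIn` — an open lattice path whose `δ`-neighbourhood
  stays in `A` is a connected set of `A` off every interface trace (open–open edges miss the
  traces, `segment_disjoint_polyTrace_of_mem`), so it stays in one component;
* the closed side is the open side of the complement: the reversed loops are interface loops of
  `ωᶜ` with the same traces (`IsSiteInterfaceLoop.reverse_compl`, `polyTrace_reverse`,
  `SiteInterfaceReverse.lean`), and vertex `k` of the reverse is vertex `n - k`;
* `exists_arm_of_chain` — a chain of sites crossing the shell contains an arm of the hexagonal
  annulus (`PathIn.exists_arm_of_triNorm_le`; radii compared through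
  `(√3/2) |v|_𝕋 ≤ ‖v‖ ≤ |v|_𝕋`, `closedBall_triMeshPoint_subset_shell`);
* `mem_altFourArm_of_vertexTraversals` — assembly through `mem_altFourArm_of_pathIn`
  (`CutPointAltArms.lean`): open and closed arms are disjoint, arms in distinct sectors are
  disjoint, and an open (closed) path of the annulus between the two open (closed) arms would join
  two distinct components;
* `mem_altFourArm_of_hasTraversals` (+ the one-loop and two-loop forms) — from traversals in time
  (`IsSiteInterfaceLoop.polyIdx_add_three_le`: a traversal spans at least three pieces).

Margins: `ρ + 5δ ≤ q₁`, `q₁ + 40δ ≤ q₂`, `q₂ + 5δ ≤ R`, `q₁ + 9δ ≤ (√3/2) δ r₁`, `δ r₂ ≤ q₂ - 9δ`,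
`r₁ ≤ r₂` (all absorbed in the scaling limit, where `δ → 0` at fixed `ρ < R`). Everything is proved;
no definitions and no named facts are introduced. What this leaves for (16)₄ along the loop route:
the converse dictionary (alternating arms ⇒ interface crossings, the two-arm proof of
`exists_interfaceWalk_of_mem_armEvent_two` run twice), the portmanteau step under the loop limit,
and — specific to four arms — an a-priori bound excluding two distinct macroscopic crossing
interfaces at vanishing loop-distance (the closure of the two-loop event in the loop-collection
topology contains single crossing loops), cf. the corollary following that lemma in GPS 2013, §2.4 (arXiv: Cor. 6, `P[𝒜₄^δ | 𝒜₄] ≥ 1 - cδ^γ`),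
whose proof uses a-priori arm estimates (7 arms in the plane, 3 and 4 arms in the half-plane).

## References

* M. Aizenman, A. Burchard, Hölder regularity and dimension bounds for random curves, Duke Math.
  J. 99 (1999), Appendix A [AizenmanBurchardDuke1999].
* S. Smirnov, W. Werner, Math. Res. Lett. 8 (2001) 729–744, §4, Remark 6, (15), (16)
  [SmirnovWernerMRL2001].
* C. Garban, G. Pete, O. Schramm, Pivotal, cluster and interface measures for critical planar
  percolation, J. Amer. Math. Soc. 26 (2013), §2.4 (arXiv 1008.1378, §2.4, proof of the lemma on
  the measurability of arm events, cases `𝒜₄`, `𝒜₂`) [GarbanPeteSchramm2013Pivotal].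
* F. Camia, C. M. Newman, Comm. Math. Phys. 268 (2006), §4 (interfaces as oriented loops)
  [CamiaNewman2006].

Tree: `IsSiteInterfaceLoop.exists_traversal_data'`, `pieceMid_mem_closure_connectedComponentIn_of_family`,
`leftPt_mem_connectedComponentIn_of_family` (`LoopCrossingArms.lean`), `not_three_arcs_touch`
(`AnnulusArcs.lean`), `toCurve_injOn_of_isCycle`, `exists_time_of_polyIdx`, `toCurve_mem_polyPiece`,
`pieceIdx_le_iff`, `mem_altFourArm_of_pathIn` (`CutPointAltArms.lean`),
`PathIn.exists_arm_of_triNorm_le` (`ArmSeparationGlue.lean`), `norm_triEmbed_le_triNorm`,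
`mul_triNorm_le_norm_triEmbed` (`OneArmLSW.lean`), `Curve.IsTraversal`, `Curve.HasTraversals`
(`CurveTortuosity.lean`). Mathlib: `connectedComponentIn`, `Finset.card_le_mul_card_image`,
`Finset.one_lt_card`, `Fintype.card_sigma`.
-/

noncomputable section

open Set Metric Complex Filter MeasureTheory
open Literature.Topology.PlaneTopology Literature.Probability.RandomPlanarGeometry
open scoped unitInterval Topology

namespace Literature.Probability.Percolation

open LatticeModels

/-! ### Monochromatic lattice paths stay in one component off the interface traces -/

/-- **An open lattice path whose `δ`-neighbourhood stays in `A` runs inside one component of `A`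
minus the traces of any family of interface loops of `ω`**: consecutive open sites are joined by an
open–open edge of `δ𝕋`, which misses every interface trace (`segment_disjoint_polyTrace_of_mem`).
[folklore] -/
theorem PathIn.triMeshPoint_mem_connectedComponentIn {ω : SiteConfig (Site 2)} {δ : ℝ} (hδ : 0 < δ)
    {ι : Type*} {f : ι → HexVertex} {w : ∀ l, hexGraph.Walk (f l) (f l)}
    (hw : ∀ l, IsSiteInterfaceLoop ω (w l)) {A : Set ℂ} {S : Set (Site 2)} (hS : S ⊆ ω)
    (hball : ∀ z ∈ S, closedBall (triMeshPoint δ z) δ ⊆ A) {u v : Site 2} (h : PathIn triGraph S u v) :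
    triMeshPoint δ v ∈ connectedComponentIn (A \ ⋃ l, polyTrace δ (w l)) (triMeshPoint δ u) := by
  have hoff : ∀ z : Site 2, z ∈ S → triMeshPoint δ z ∈ A \ ⋃ l, polyTrace δ (w l) := fun z hz ↦
    ⟨hball z hz (mem_closedBall_self hδ.le), fun hz' ↦ by
      obtain ⟨l, hl⟩ := mem_iUnion.1 hz'
      exact (hw l).triMeshPoint_not_mem_polyTrace hδ _ hl⟩
  obtain ⟨hu, huv⟩ := h
  induction huv with
  | refl => exact mem_connectedComponentIn (hoff u hu)
  | @tail b c hub hbc ih =>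
    have hb : b ∈ S := by
      -- the end of the path so far is in `S`
      exact (show PathIn triGraph S u b from ⟨hu, hub⟩).right_mem
    have hseg : segment ℝ (triMeshPoint δ b) (triMeshPoint δ c) ⊆ A \ ⋃ l, polyTrace δ (w l) := by
      intro z hz
      refine ⟨hball b hb ?_, fun hz' ↦ ?_⟩
      · have hd := dist_triMeshPoint_le_of_eq_or_adj hδ.le (Or.inr hbc.1 : b = c ∨ triGraph.Adj b c)
        exact (convex_closedBall _ _).segment_subset (mem_closedBall_self hδ.le)
          (mem_closedBall.2 (by rw [dist_comm]; exact hd)) hz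
      · obtain ⟨l, hl⟩ := mem_iUnion.1 hz'
        exact disjoint_left.1 ((hw l).segment_disjoint_polyTrace_of_mem hδ (Or.inr hbc.1) (hS hb) (hS hbc.2)) hz hl
    have hconn : IsPreconnected (segment ℝ (triMeshPoint δ b) (triMeshPoint δ c)) :=
      (convex_segment _ _).isPreconnected
    have hc_mem : triMeshPoint δ c ∈ connectedComponentIn (A \ ⋃ l, polyTrace δ (w l)) (triMeshPoint δ b) :=
      hconn.subset_connectedComponentIn (left_mem_segment _ _ _) hseg (right_mem_segment _ _ _)
    rw [connectedComponentIn_eq ih]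
    exact hc_mem

/-! ### Two open chains in distinct sectors from three crossing arcs -/

/-- **Three strict crossings of a shell by interface loops give two open chains in distinct
sectors** (the sector argument of Aizenman–Burchard 1999, App. A, as in
`mem_disjointOccurrencePow_of_loops` / `mem_disjointOccurrencePow_of_hasTraversals`, for a finite
family of loops with several traversals each). Let interface loops `w l` (`l : ι`, finite) of `ω`
at mesh `δ` have pairwise disjoint traces, and let loop `l` traverse `D(x; ρ, R)` on `k l` time
intervals `[s l i, t l i]` (from positive times, pairwise separated), with `Σ k l ≥ 3`,
`0 < q₁`, `ρ ≤ q₁`, `q₁ + 40δ ≤ q₂ ≤ R`. Then two of these traversals carry stretches of left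
(open) sites of their loops, `lv k₀ … lv k₁` and `lv k₀' … lv k₁'`, crossing
`A(x; q₁ + 9δ, q₂ - 9δ)` with their `δ`-discs inside the open shell `U = {q₁ < |z - x| < q₂}`,
such that **no point of the second stretch lies in the component, in `U` minus all the traces, of
a point of the first**: each traversal contains a strict crossing arc, the arcs are pairwise
disjoint, the component of the left hexagon of the middle dart of an arc touches that arc, so by
`not_three_arcs_touch` the components are at most two-to-one on the `≥ 3` arcs. [cite: AizenmanBurchardDuke1999, Appendix A] -/
theorem exists_two_left_chains_of_traversals {ω : SiteConfig (Site 2)} {δ : ℝ} (hδ : 0 < δ) {x : ℂ}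
    {ρ R q₁ q₂ : ℝ} (hq₁ : 0 < q₁) (hρq : ρ ≤ q₁) (hgap : q₁ + 40 * δ ≤ q₂) (hqR : q₂ ≤ R)
    {ι : Type*} [Fintype ι] {f : ι → HexVertex} {w : ∀ l, hexGraph.Walk (f l) (f l)}
    (hw : ∀ l, IsSiteInterfaceLoop ω (w l))
    (hdis : ∀ l l', l ≠ l' → Disjoint (polyTrace δ (w l)) (polyTrace δ (w l')))
    (k : ι → ℕ) (hk : 3 ≤ ∑ l, k l) (s t : ∀ l, Fin (k l) → I)
    (hs0 : ∀ l i, 0 < (s l i : ℝ))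
    (htr : ∀ l i, (hexLoopCurve δ (w l)).IsTraversal x ρ R (s l i) (t l i))
    (hsep : ∀ l (i j : Fin (k l)), i ≠ j → t l i < s l j ∨ t l j < s l i) :
    ∃ (l l' : ι) (k₀ k₁ k₀' k₁' : ℕ), k₀ ≤ k₁ ∧ k₁ < (w l).length ∧ k₀' ≤ k₁' ∧ k₁' < (w l').length ∧
      (∀ p, k₀ ≤ p → p ≤ k₁ → ∀ p', k₀' ≤ p' → p' ≤ k₁' →
        (hw l').leftPt δ p' ∉ connectedComponentIn
          ({z | q₁ < dist z x ∧ dist z x < q₂} \ ⋃ l₀, polyTrace δ (w l₀)) ((hw l).leftPt δ p)) ∧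
      (∀ p, k₀ ≤ p → p ≤ k₁ → closedBall ((hw l).leftPt δ p) δ ⊆ {z | q₁ < dist z x ∧ dist z x < q₂}) ∧
      (∀ p', k₀' ≤ p' → p' ≤ k₁' → closedBall ((hw l').leftPt δ p') δ ⊆ {z | q₁ < dist z x ∧ dist z x < q₂}) ∧
      ((dist ((hw l).leftPt δ k₀) x ≤ q₁ + 9 * δ ∧ q₂ - 9 * δ ≤ dist ((hw l).leftPt δ k₁) x) ∨
        (q₂ - 9 * δ ≤ dist ((hw l).leftPt δ k₀) x ∧ dist ((hw l).leftPt δ k₁) x ≤ q₁ + 9 * δ)) ∧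
      ((dist ((hw l').leftPt δ k₀') x ≤ q₁ + 9 * δ ∧ q₂ - 9 * δ ≤ dist ((hw l').leftPt δ k₁') x) ∨
        (q₂ - 9 * δ ≤ dist ((hw l').leftPt δ k₀') x ∧ dist ((hw l').leftPt δ k₁') x ≤ q₁ + 9 * δ)) := by
  classical
  set U : Set ℂ := {z | q₁ < dist z x ∧ dist z x < q₂} with hU
  set K : Set ℂ := ⋃ l, polyTrace δ (w l) with hK
  have hq : q₁ < q₂ := by linarith
  have hlen : ∀ l, 0 < (w l).length := fun l ↦ by have := (hw l).three_le_length; omega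
  -- the arcs, indexed by `Σ l, Fin (k l)`
  choose a b dir m k₀ k₁ hsa hab hbt htimes hA hB hstrict hmlt hMmem hMU hballU hk₀k₁ hk₁ hk₀m hmk₁ hballs hconf hends using
    fun α : Σ l, Fin (k l) ↦ (hw α.1).exists_traversal_data' hδ hρq hgap hqR (hs0 α.1 α.2) (htr α.1 α.2)
  /- the components of the left hexagons of the middle darts, off ALL traces -/
  set comp : (Σ l, Fin (k l)) → Set ℂ := fun α ↦ connectedComponentIn (U \ K) ((hw α.1).leftPt δ (m α))
    with hcompdef
  have hMcl : ∀ α, pieceMid δ (w α.1) (m α) ∈ closure (comp α) := fun α ↦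
    pieceMid_mem_closure_connectedComponentIn_of_family hδ hw hdis α.1 (hmlt α) (hballU α)
  have hcomp : ∀ α p, k₀ α ≤ p → p ≤ k₁ α → (hw α.1).leftPt δ p ∈ comp α := fun α p hp1 hp2 ↦
    leftPt_mem_connectedComponentIn_of_family hδ hw α.1 (hk₁ α) (hballs α) hp1 hp2 (hk₀m α) (hmk₁ α)
  /- the arcs -/
  set arc : ∀ _ : (Σ l, Fin (k l)), Σ p : ℂ × ℂ, Path p.1 p.2 :=
    fun α ↦ orientedArc (hexLoopCurve δ (w α.1)) (a α) (b α) (hab α).le (dir α) with harc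
  have harc1 : ∀ α, (arc α).1 = if dir α then (hexLoopCurve δ (w α.1) (a α), hexLoopCurve δ (w α.1) (b α))
      else (hexLoopCurve δ (w α.1) (b α), hexLoopCurve δ (w α.1) (a α)) :=
    fun α ↦ orientedArc_fst (hexLoopCurve δ (w α.1)) (hab α).le (dir α)
  have hrange : ∀ α, range (arc α).2 = hexLoopCurve δ (w α.1) '' {v | a α ≤ v ∧ v ≤ b α} :=
    fun α ↦ range_orientedArc (hexLoopCurve δ (w α.1)) (hab α).le (dir α)
  -- points of an arc: distances, and the only points on the circles
  have hpt : ∀ α (v : I), a α ≤ v → v ≤ b α →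
      (dist (hexLoopCurve δ (w α.1) v) x = q₁ → hexLoopCurve δ (w α.1) v = (arc α).1.1) ∧
      (dist (hexLoopCurve δ (w α.1) v) x = q₂ → hexLoopCurve δ (w α.1) v = (arc α).1.2) ∧
      q₁ ≤ dist (hexLoopCurve δ (w α.1) v) x ∧ dist (hexLoopCurve δ (w α.1) v) x ≤ q₂ := by
    intro α v hav hvb
    have h1 := hA α; have h2 := hB α; have h3 := harc1 α
    cases hd : dir α
    · simp only [hd, Bool.false_eq_true, ↓reduceIte] at h1 h2 h3
      rw [h3]
      rcases eq_or_lt_of_le hav with h | h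
      · subst h; exact ⟨fun h' ↦ by rw [h1] at h'; linarith, fun _ ↦ rfl, by rw [h1]; exact hq.le, by rw [h1]⟩
      rcases eq_or_lt_of_le hvb with h' | h'
      · subst h'; exact ⟨fun _ ↦ rfl, fun h'' ↦ by rw [h2] at h''; linarith, by rw [h2], by rw [h2]; exact hq.le⟩
      have := hstrict α v h h'
      exact ⟨fun h'' ↦ by linarith [this.1], fun h'' ↦ by linarith [this.2], this.1.le, this.2.le⟩
    · simp only [hd, ↓reduceIte] at h1 h2 h3
      rw [h3]
      rcases eq_or_lt_of_le hav with h | h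
      · subst h; exact ⟨fun _ ↦ rfl, fun h' ↦ by rw [h1] at h'; linarith, by rw [h1], by rw [h1]; exact hq.le⟩
      rcases eq_or_lt_of_le hvb with h' | h'
      · subst h'; exact ⟨fun h'' ↦ by rw [h2] at h''; linarith, fun _ ↦ rfl, by rw [h2]; exact hq.le, by rw [h2]⟩
      have := hstrict α v h h'
      exact ⟨fun h'' ↦ by linarith [this.1], fun h'' ↦ by linarith [this.2], this.1.le, this.2.le⟩
  have he : ∀ α, dist (arc α).1.1 x = q₁ := by
    intro α; have h1 := hA α; have h2 := hB α; rw [harc1]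
    cases hd : dir α
    · simp only [hd, Bool.false_eq_true, ↓reduceIte] at h1 h2 ⊢; exact h2
    · simp only [hd, ↓reduceIte] at h1 h2 ⊢; exact h1
  have hf : ∀ α, dist (arc α).1.2 x = q₂ := by
    intro α; have h1 := hA α; have h2 := hB α; rw [harc1]
    cases hd : dir α
    · simp only [hd, Bool.false_eq_true, ↓reduceIte] at h1 h2 ⊢; exact h1
    · simp only [hd, ↓reduceIte] at h1 h2 ⊢; exact h2
  have hmemarc : ∀ α (u : I), ∃ v : I, a α ≤ v ∧ v ≤ b α ∧ (arc α).2 u = hexLoopCurve δ (w α.1) v := by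
    intro α u
    have : (arc α).2 u ∈ range (arc α).2 := ⟨u, rfl⟩
    rw [hrange] at this
    obtain ⟨v, ⟨h1, h2⟩, h3⟩ := this
    exact ⟨v, h1, h2, h3.symm⟩
  -- the arcs are pairwise disjoint: distinct loops have disjoint traces; on one loop the time
  -- intervals are disjoint and the polygon is injective off the base point
  have hdisj : ∀ α β, α ≠ β → Disjoint (range (arc α).2) (range (arc β).2) := by
    rintro ⟨l, i⟩ ⟨l', j⟩ hne
    rw [hrange, hrange]
    by_cases hll' : l = l'
    · subst hll'
      have hij : i ≠ j := fun e ↦ hne (by rw [e])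
      have hinj := toCurve_injOn_of_isCycle hδ.ne' (hw l).isCycle
      refine disjoint_left.2 ?_
      rintro z ⟨v, ⟨hv1, hv2⟩, rfl⟩ ⟨v', ⟨hv1', hv2'⟩, hvv'⟩
      have heq : v = v' :=
        hinj (htimes ⟨l, i⟩ v hv1 hv2) (htimes ⟨l, j⟩ v' hv1' hv2') hvv'.symm
      subst heq
      rcases hsep l i j hij with h | h
      · have := lt_of_le_of_lt (hv2.trans (hbt ⟨l, i⟩)) (h.trans_le ((hsa ⟨l, j⟩).trans hv1'))
        exact lt_irrefl _ this
      · have := lt_of_le_of_lt (hv2'.trans (hbt ⟨l, j⟩)) (h.trans_le ((hsa ⟨l, i⟩).trans hv1))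
        exact lt_irrefl _ this
    · refine Set.disjoint_of_subset ?_ ?_ (hdis l l' hll')
      · rintro _ ⟨v, -, rfl⟩; exact range_toCurve_subset_polyTrace (hlen l) ⟨v, rfl⟩
      · rintro _ ⟨v, -, rfl⟩; exact range_toCurve_subset_polyTrace (hlen l') ⟨v, rfl⟩
  -- the components miss the arcs
  have hcompsub : ∀ α, comp α ⊆ U \ K := fun α ↦ connectedComponentIn_subset _ _
  have hST : ∀ α β, Disjoint (comp α) (range (arc β).2) := by
    intro α β
    rw [hrange]
    refine disjoint_left.2 ?_
    rintro z hz ⟨v, -, rfl⟩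
    exact (hcompsub α hz).2 (mem_iUnion.2 ⟨β.1, range_toCurve_subset_polyTrace (hlen β.1) ⟨v, rfl⟩⟩)
  /- no three components coincide -/
  have hfib : ∀ α β γ : (Σ l, Fin (k l)), α ≠ β → β ≠ γ → γ ≠ α →
      comp α = comp β → comp β = comp γ → False := by
    intro α β γ h12 h23 h31 e12 e23
    have htouch : ∀ β', comp α = comp β' → (closure (comp α) ∩ range (arc β').2 ∩ U).Nonempty := by
      intro β' e
      refine ⟨pieceMid δ (w β'.1) (m β'), ⟨?_, ?_⟩, hMU β'⟩
      · rw [e]; exact hMcl β'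
      · rw [hrange]; exact hMmem β'
    exact not_three_arcs_touch hq₁ hq (fun β' ↦ (arc β').2) he hf
      (fun β' u ↦ by obtain ⟨v, h1, h2, h3⟩ := hmemarc β' u; rw [h3]; exact ⟨(hpt β' v h1 h2).2.2.1, (hpt β' v h1 h2).2.2.2⟩)
      (fun β' u hu ↦ by obtain ⟨v, h1, h2, h3⟩ := hmemarc β' u; rw [h3] at hu ⊢; exact (hpt β' v h1 h2).1 hu)
      (fun β' u hu ↦ by obtain ⟨v, h1, h2, h3⟩ := hmemarc β' u; rw [h3] at hu ⊢; exact (hpt β' v h1 h2).2.1 hu)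
      hdisj isPreconnected_connectedComponentIn (fun z hz ↦ (hcompsub α hz).1) (hST α) h12 h23 h31
      (htouch α rfl) (htouch β e12) (htouch γ (e12.trans e23))
  /- counting: at least two distinct components -/
  have hcardA : Fintype.card (Σ l, Fin (k l)) = ∑ l, k l := by
    rw [Fintype.card_sigma]
    simp
  have hcard : Fintype.card (Σ l, Fin (k l)) ≤ 2 * (Finset.univ.image comp).card := by
    have h := Finset.card_le_mul_card_image (Finset.univ : Finset (Σ l, Fin (k l))) (f := comp) 2 ?_
    · simpa using h
    intro y hy
    by_contra hgt
    push Not at hgt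
    obtain ⟨α, hα, β, hβ, γ, hγ, h12, h13, h23⟩ := exists_three_of_two_lt_card hgt
    simp only [Finset.mem_filter, Finset.mem_univ, true_and] at hα hβ hγ
    exact hfib α β γ h12 h23 (Ne.symm h13) (hα.trans hβ.symm) (hβ.trans hγ.symm)
  have hF2 : 1 < (Finset.univ.image comp).card := by
    rw [hcardA] at hcard
    omega
  obtain ⟨S₁, hS₁, S₂, hS₂, hS⟩ := Finset.one_lt_card.1 hF2
  obtain ⟨α, -, hα⟩ := Finset.mem_image.1 hS₁
  obtain ⟨β, -, hβ⟩ := Finset.mem_image.1 hS₂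
  have hαβ : comp α ≠ comp β := by rw [hα, hβ]; exact hS
  /- the two chains -/
  refine ⟨α.1, β.1, k₀ α, k₁ α, k₀ β, k₁ β, hk₀k₁ α, hk₁ α, hk₀k₁ β, hk₁ β, ?_, hballs α, hballs β, hends α, hends β⟩
  intro p hp1 hp2 p' hp1' hp2' hmem
  apply hαβ
  have h1 := hcomp α p hp1 hp2
  have h2 := hcomp β p' hp1' hp2'
  change connectedComponentIn (U \ K) ((hw α.1).leftPt δ (m α)) = connectedComponentIn (U \ K) ((hw β.1).leftPt δ (m β))
  rw [connectedComponentIn_eq h1, connectedComponentIn_eq h2]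
  exact connectedComponentIn_eq hmem


/-! ### Times attached to vertex indices of a hexagonal polygon -/

/-- The piece index at time `0` is `0`. [folklore] -/
theorem polyIdx_zero (n : ℕ) : polyIdx n 0 = 0 := by
  have h : pieceIdx (List.replicate n (0 : ℕ)) 0 ≤ 0 := by
    rw [pieceIdx_le_iff]
    left
    norm_num
  unfold polyIdx
  omega

/-- The piece index at time `1` is the last one, `n - 1`. [folklore] -/
theorem polyIdx_one {n : ℕ} (hn : 0 < n) : polyIdx n 1 = n - 1 := by
  have hlen : (List.replicate n (0 : ℕ)).length = n := List.length_replicate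
  have h : n - 1 ≤ pieceIdx (List.replicate n (0 : ℕ)) 1 := by
    rcases Nat.lt_or_ge n 2 with h2 | h2
    · omega
    · by_contra hlt
      push Not at hlt
      have h' : pieceIdx (List.replicate n (0 : ℕ)) 1 ≤ n - 2 := by omega
      rw [pieceIdx_le_iff, hlen] at h'
      rcases h' with h' | h'
      · have hp : (0 : ℝ) < (1 / 2 : ℝ) ^ (n - 2 + 1) := by positivity
        have h1 : ((1 : I) : ℝ) = 1 := rfl
        rw [h1] at h'
        linarith
      · omega
  unfold polyIdx
  exact le_antisymm (min_le_right _ _) (le_min h (le_refl _))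

/-- **Every dart piece is visited**: for `k < n` there is a time whose piece index is `k`.
[folklore] -/
theorem exists_time_polyIdx_eq {n k : ℕ} (hk : k < n) : ∃ u : I, polyIdx n u = k := by
  obtain ⟨u, -, -, hu⟩ := exists_time_of_polyIdx n (s := 0) (t := 1) zero_le_one (i := k)
    (by rw [polyIdx_zero]; exact Nat.zero_le _) (by rw [polyIdx_one (by omega)]; omega)
  exact ⟨u, hu⟩

/-- Times are ordered like their piece indices (contrapositive of `polyIdx_mono`). [folklore] -/
theorem lt_of_polyIdx_lt {n : ℕ} {u v : I} (h : polyIdx n u < polyIdx n v) : u < v := by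
  by_contra huv
  exact absurd (polyIdx_mono n (not_lt.1 huv)) (not_le.2 h)

/-- A time with positive piece index is positive. [folklore] -/
theorem pos_of_polyIdx_pos {n : ℕ} {u : I} (h : 0 < polyIdx n u) : 0 < (u : ℝ) := by
  have hu : (0 : I) < u := lt_of_polyIdx_lt (by rwa [polyIdx_zero])
  exact_mod_cast hu

section OneLoop

variable {ω : SiteConfig (Site 2)} {f₀ : HexVertex} {w : hexGraph.Walk f₀ f₀}
  (hw : IsSiteInterfaceLoop ω w) {δ : ℝ} (hδ : 0 < δ)

include hw hδ

/-- **The polygon passes within `2δ` of each of its vertices at a time with that piece index**: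
for `k < n` there is a time `u` with `polyIdx u = k`, and then `Γ u` lies on the `k`-th piece,
within `δ` of its left point, as is the vertex `polyPt k`. [folklore] -/
theorem IsSiteInterfaceLoop.exists_time_near_polyPt {k : ℕ} (hk : k < w.length) :
    ∃ u : I, polyIdx w.length u = k ∧ dist (hexLoopCurve δ w u) (polyPt δ w k) ≤ 2 * δ := by
  obtain ⟨u, hu⟩ := exists_time_polyIdx_eq hk
  refine ⟨u, hu, ?_⟩
  have h1 : hexLoopCurve δ w u ∈ closedBall (hw.leftPt δ k) δ := by
    have := toCurve_mem_polyPiece (δ := δ) (w := w) (by omega) u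
    rw [hu] at this
    exact hw.polyPiece_subset_closedBall hδ.le hk this
  have h2 := (hw.dist_polyPt_leftPt_le hδ.le hk).1
  rw [mem_closedBall] at h1
  linarith [dist_triangle (hexLoopCurve δ w u) (hw.leftPt δ k) (polyPt δ w k), dist_comm (hw.leftPt δ k) (polyPt δ w k)]

end OneLoop

/-! ### Two open chains in distinct sectors from three crossings given by vertex indices -/

/-- **Vertex form of `exists_two_left_chains_of_traversals`.** The traversals of loop `l` are now
given by pairs of vertex indices `1 ≤ a l i < b l i < n_l` of its polygon with `polyPt (a l i)`
within `ρ` of `x` and `polyPt (b l i)` beyond `R` (or conversely), pairwise separated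
(`b l i < a l j` or `b l j < a l i`), with `ρ + 2δ ≤ q₁`, `q₂ + 2δ ≤ R`: the times with these piece
indices (`exists_time_near_polyPt`) are positive, ordered like the indices, and give traversals
of `D(x; ρ + 2δ, R - 2δ)`. This form is invariant under reversing the loops (vertex `k` of the
reverse is vertex `n - k`), which is how it is applied to the closed side.
[cite: AizenmanBurchardDuke1999, Appendix A] -/
theorem exists_two_left_chains_of_vertices {ω : SiteConfig (Site 2)} {δ : ℝ} (hδ : 0 < δ) {x : ℂ}
    {ρ R q₁ q₂ : ℝ} (hq₁ : 0 < q₁) (hρq : ρ + 2 * δ ≤ q₁) (hgap : q₁ + 40 * δ ≤ q₂) (hqR : q₂ + 2 * δ ≤ R)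
    {ι : Type*} [Fintype ι] {f : ι → HexVertex} {w : ∀ l, hexGraph.Walk (f l) (f l)}
    (hw : ∀ l, IsSiteInterfaceLoop ω (w l))
    (hdis : ∀ l l', l ≠ l' → Disjoint (polyTrace δ (w l)) (polyTrace δ (w l')))
    (k : ι → ℕ) (hk : 3 ≤ ∑ l, k l) (a b : ∀ l, Fin (k l) → ℕ)
    (ha : ∀ l i, 1 ≤ a l i) (hab : ∀ l i, a l i < b l i) (hb : ∀ l i, b l i < (w l).length)
    (hrad : ∀ l i, (dist (polyPt δ (w l) (a l i)) x ≤ ρ ∧ R ≤ dist (polyPt δ (w l) (b l i)) x) ∨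
      (R ≤ dist (polyPt δ (w l) (a l i)) x ∧ dist (polyPt δ (w l) (b l i)) x ≤ ρ))
    (hsep : ∀ l (i j : Fin (k l)), i ≠ j → b l i < a l j ∨ b l j < a l i) :
    ∃ (l l' : ι) (k₀ k₁ k₀' k₁' : ℕ), k₀ ≤ k₁ ∧ k₁ < (w l).length ∧ k₀' ≤ k₁' ∧ k₁' < (w l').length ∧
      (∀ p, k₀ ≤ p → p ≤ k₁ → ∀ p', k₀' ≤ p' → p' ≤ k₁' →
        (hw l').leftPt δ p' ∉ connectedComponentIn
          ({z | q₁ < dist z x ∧ dist z x < q₂} \ ⋃ l₀, polyTrace δ (w l₀)) ((hw l).leftPt δ p)) ∧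
      (∀ p, k₀ ≤ p → p ≤ k₁ → closedBall ((hw l).leftPt δ p) δ ⊆ {z | q₁ < dist z x ∧ dist z x < q₂}) ∧
      (∀ p', k₀' ≤ p' → p' ≤ k₁' → closedBall ((hw l').leftPt δ p') δ ⊆ {z | q₁ < dist z x ∧ dist z x < q₂}) ∧
      ((dist ((hw l).leftPt δ k₀) x ≤ q₁ + 9 * δ ∧ q₂ - 9 * δ ≤ dist ((hw l).leftPt δ k₁) x) ∨
        (q₂ - 9 * δ ≤ dist ((hw l).leftPt δ k₀) x ∧ dist ((hw l).leftPt δ k₁) x ≤ q₁ + 9 * δ)) ∧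
      ((dist ((hw l').leftPt δ k₀') x ≤ q₁ + 9 * δ ∧ q₂ - 9 * δ ≤ dist ((hw l').leftPt δ k₁') x) ∨
        (q₂ - 9 * δ ≤ dist ((hw l').leftPt δ k₀') x ∧ dist ((hw l').leftPt δ k₁') x ≤ q₁ + 9 * δ)) := by
  -- times at the vertices
  have hsa : ∀ l i, ∃ u : I, polyIdx (w l).length u = a l i ∧
      dist (hexLoopCurve δ (w l) u) (polyPt δ (w l) (a l i)) ≤ 2 * δ :=
    fun l i ↦ (hw l).exists_time_near_polyPt hδ ((hab l i).trans (hb l i))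
  have htb : ∀ l i, ∃ u : I, polyIdx (w l).length u = b l i ∧
      dist (hexLoopCurve δ (w l) u) (polyPt δ (w l) (b l i)) ≤ 2 * δ :=
    fun l i ↦ (hw l).exists_time_near_polyPt hδ (hb l i)
  choose s hs hsd using hsa
  choose t ht htd using htb
  refine exists_two_left_chains_of_traversals hδ hq₁ (ρ := ρ + 2 * δ) (R := R - 2 * δ) hρq hgap
    (by linarith) hw hdis k hk s t (fun l i ↦ ?_) (fun l i ↦ ?_) (fun l i j hij ↦ ?_)
  · -- positivity
    exact pos_of_polyIdx_pos (by rw [hs]; exact ha l i)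
  · -- traversal
    refine ⟨(lt_of_polyIdx_lt (by rw [hs, ht]; exact hab l i)).le, ?_⟩
    have h1 := hsd l i
    have h2 := htd l i
    rcases hrad l i with ⟨h3, h4⟩ | ⟨h3, h4⟩
    · left
      constructor
      · linarith [dist_triangle (hexLoopCurve δ (w l) (s l i)) (polyPt δ (w l) (a l i)) x]
      · linarith [dist_triangle (polyPt δ (w l) (b l i)) (hexLoopCurve δ (w l) (t l i)) x,
          dist_comm (polyPt δ (w l) (b l i)) (hexLoopCurve δ (w l) (t l i))]
    · right
      constructor
      · linarith [dist_triangle (polyPt δ (w l) (a l i)) (hexLoopCurve δ (w l) (s l i)) x,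
          dist_comm (polyPt δ (w l) (a l i)) (hexLoopCurve δ (w l) (s l i))]
      · linarith [dist_triangle (hexLoopCurve δ (w l) (t l i)) (polyPt δ (w l) (b l i)) x]
  · -- separation
    rcases hsep l i j hij with h | h
    · exact Or.inl (lt_of_polyIdx_lt (by rw [ht, hs]; exact h))
    · exact Or.inr (lt_of_polyIdx_lt (by rw [ht, hs]; exact h))


/-! ### Lattice bookkeeping: chains of sites, Euclidean and graph norms -/

/-- **A chain of sites is a path in its own site set**: if consecutive sites of `c 0, …, c N` are
equal or adjacent, `c 0` is joined to `c N` inside `{c p | p ≤ N}`. [folklore] -/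
theorem pathIn_of_chain (c : ℕ → Site 2) (N : ℕ)
    (hstep : ∀ p < N, c p = c (p + 1) ∨ triGraph.Adj (c p) (c (p + 1))) :
    PathIn triGraph {v | ∃ p ≤ N, v = c p} (c 0) (c N) := by
  have key : ∀ p ≤ N, PathIn triGraph {v | ∃ p ≤ N, v = c p} (c 0) (c p) := by
    intro p
    induction p with
    | zero => exact fun _ ↦ PathIn.refl ⟨0, Nat.zero_le _, rfl⟩
    | succ p ih =>
      intro hp
      have h := ih (by omega)
      rcases hstep p (by omega) with he | hadj
      · rw [← he]; exact h
      · exact h.tail hadj ⟨p + 1, hp, rfl⟩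
  exact key N le_rfl

/-- The Euclidean norm of a mesh point: `‖δ x‖ = δ ‖x‖`. [folklore] -/
theorem norm_triMeshPoint_eq {δ : ℝ} (hδ : 0 ≤ δ) (v : Site 2) : ‖triMeshPoint δ v‖ = δ * ‖triEmbed v‖ := by
  rw [triMeshPoint, norm_mul, Complex.norm_real, Real.norm_of_nonneg hδ]

/-- **Inner radius**: a site whose mesh point has Euclidean norm `≤ q₁ + 9δ ≤ (√3/2) δ r₁` has graph
norm `≤ r₁` (the hexagon `Λ_{r₁}` contains the disc of radius `(√3/2) r₁`,
`mul_triNorm_le_norm_triEmbed`). [folklore] -/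
theorem triNorm_le_of_norm_triMeshPoint_le {δ : ℝ} (hδ : 0 < δ) {q : ℝ} {r₁ : ℕ}
    (hr₁ : q ≤ Real.sqrt 3 / 2 * (δ * r₁)) {v : Site 2} (hv : ‖triMeshPoint δ v‖ ≤ q) :
    triNorm v ≤ r₁ := by
  rw [norm_triMeshPoint_eq hδ.le] at hv
  have h1 := mul_triNorm_le_norm_triEmbed v
  have h2 : Real.sqrt 3 / 2 * (δ * (triNorm v : ℝ)) ≤ Real.sqrt 3 / 2 * (δ * r₁) := by
    calc Real.sqrt 3 / 2 * (δ * (triNorm v : ℝ)) = δ * (Real.sqrt 3 / 2 * (triNorm v : ℝ)) := by ring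
      _ ≤ δ * ‖triEmbed v‖ := mul_le_mul_of_nonneg_left h1 hδ.le
      _ ≤ q := hv
      _ ≤ _ := hr₁
  have h3 : (0 : ℝ) < Real.sqrt 3 / 2 * δ := by positivity
  have h4 : (triNorm v : ℝ) ≤ r₁ := by
    have := h2
    nlinarith
  exact_mod_cast h4

/-- **Outer radius**: a site whose mesh point has Euclidean norm `≥ δ r₂` has graph norm `≥ r₂`
(the hexagon `Λ_n` lies in the disc of radius `n`, `norm_triEmbed_le_triNorm`). [folklore] -/
theorem le_triNorm_of_le_norm_triMeshPoint {δ : ℝ} (hδ : 0 < δ) {r₂ : ℕ} {v : Site 2}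
    (hv : δ * r₂ ≤ ‖triMeshPoint δ v‖) : (r₂ : ℤ) ≤ triNorm v := by
  rw [norm_triMeshPoint_eq hδ.le] at hv
  have h1 := norm_triEmbed_le_triNorm v
  have h2 : δ * (r₂ : ℝ) ≤ δ * (triNorm v : ℝ) := hv.trans (mul_le_mul_of_nonneg_left h1 hδ.le)
  have h3 : (r₂ : ℝ) ≤ (triNorm v : ℝ) := le_of_mul_le_mul_left h2 hδ
  exact_mod_cast h3

/-- **The hexagonal annulus lies well inside the round shell**: if `q₁ + 9δ ≤ (√3/2) δ r₁` and
`δ r₂ ≤ q₂ - 9δ`, the closed `δ`-disc about the mesh point of any site of `{r₁ ≤ |·|_𝕋 ≤ r₂}` lies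
in the open shell `{q₁ < |z| < q₂}`. [folklore] -/
theorem closedBall_triMeshPoint_subset_shell {δ : ℝ} (hδ : 0 < δ) {q₁ q₂ : ℝ} {r₁ r₂ : ℕ}
    (hr₁ : q₁ + 9 * δ ≤ Real.sqrt 3 / 2 * (δ * r₁)) (hr₂ : δ * r₂ ≤ q₂ - 9 * δ) {v : Site 2}
    (hv : (r₁ : ℤ) ≤ triNorm v ∧ triNorm v ≤ r₂) :
    closedBall (triMeshPoint δ v) δ ⊆ {z : ℂ | q₁ < dist z 0 ∧ dist z 0 < q₂} := by
  intro z hz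
  rw [mem_closedBall] at hz
  have hv1 : (r₁ : ℝ) ≤ (triNorm v : ℝ) := by exact_mod_cast hv.1
  have hv2 : (triNorm v : ℝ) ≤ (r₂ : ℝ) := by exact_mod_cast hv.2
  have hlow : q₁ + 9 * δ ≤ ‖triMeshPoint δ v‖ := by
    rw [norm_triMeshPoint_eq hδ.le]
    have h1 := mul_triNorm_le_norm_triEmbed v
    have h3 : (0 : ℝ) ≤ Real.sqrt 3 / 2 := by positivity
    calc q₁ + 9 * δ ≤ Real.sqrt 3 / 2 * (δ * r₁) := hr₁
      _ ≤ Real.sqrt 3 / 2 * (δ * (triNorm v : ℝ)) := by gcongr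
      _ = δ * (Real.sqrt 3 / 2 * (triNorm v : ℝ)) := by ring
      _ ≤ δ * ‖triEmbed v‖ := mul_le_mul_of_nonneg_left h1 hδ.le
  have hup : ‖triMeshPoint δ v‖ ≤ q₂ - 9 * δ := by
    rw [norm_triMeshPoint_eq hδ.le]
    have h1 := norm_triEmbed_le_triNorm v
    calc δ * ‖triEmbed v‖ ≤ δ * (triNorm v : ℝ) := mul_le_mul_of_nonneg_left h1 hδ.le
      _ ≤ δ * r₂ := by gcongr
      _ ≤ q₂ - 9 * δ := hr₂
  have hz' : dist z (triMeshPoint δ v) ≤ δ := hz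
  simp only [mem_setOf_eq, dist_zero_right]
  constructor
  · have := norm_le_norm_add_norm_sub' (triMeshPoint δ v) z
    -- `‖m‖ ≤ ‖z‖ + ‖m - z‖`, `‖m - z‖ = dist m z ≤ δ`
    rw [← dist_eq_norm, dist_comm] at this
    linarith
  · have := norm_le_norm_add_norm_sub' z (triMeshPoint δ v)
    rw [← dist_eq_norm] at this
    linarith

/-- **A chain crossing the shell contains an arm of the hexagonal annulus.** A chain `c 0, …, c N`
of sites (consecutive ones equal or adjacent) whose first mesh point has norm `≤ q₁ + 9δ` and
last `≥ q₂ - 9δ`, or conversely, contains a path of the hexagonal annulus `{r₁ ≤ |·|_𝕋 ≤ r₂}`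
from `∂Λ_{r₁}` to `∂Λ_{r₂}` whenever `q₁ + 9δ ≤ (√3/2) δ r₁`, `δ r₂ ≤ q₂ - 9δ`, `r₁ ≤ r₂`
(`PathIn.exists_arm_of_triNorm_le`: cut at the first visit of `{|·|_𝕋 ≥ r₂}` and the last visit
of `Λ_{r₁}` before it). [folklore] -/
theorem exists_arm_of_chain {δ : ℝ} (hδ : 0 < δ) {q₁ q₂ : ℝ} {r₁ r₂ : ℕ}
    (hr₁ : q₁ + 9 * δ ≤ Real.sqrt 3 / 2 * (δ * r₁)) (hr₂ : δ * r₂ ≤ q₂ - 9 * δ) (hr : r₁ ≤ r₂)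
    (c : ℕ → Site 2) (N : ℕ) (hstep : ∀ p < N, c p = c (p + 1) ∨ triGraph.Adj (c p) (c (p + 1)))
    (hends : (‖triMeshPoint δ (c 0)‖ ≤ q₁ + 9 * δ ∧ q₂ - 9 * δ ≤ ‖triMeshPoint δ (c N)‖) ∨
      (q₂ - 9 * δ ≤ ‖triMeshPoint δ (c 0)‖ ∧ ‖triMeshPoint δ (c N)‖ ≤ q₁ + 9 * δ)) :
    ∃ x ∈ triSphere r₁, ∃ y ∈ triSphere r₂,
      PathIn triGraph ({v : Site 2 | (r₁ : ℤ) ≤ triNorm v ∧ triNorm v ≤ r₂} ∩ {v | ∃ p ≤ N, v = c p}) x y := by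
  have hpath := pathIn_of_chain c N hstep
  rcases hends with ⟨h0, hN⟩ | ⟨h0, hN⟩
  · obtain ⟨x, y, hx, hy, hp⟩ := hpath.exists_arm_of_triNorm_le
      (triNorm_le_of_norm_triMeshPoint_le hδ hr₁ h0) (le_triNorm_of_le_norm_triMeshPoint hδ (hr₂.trans hN)) hr
    exact ⟨x, mem_triSphere_iff.2 hx, y, mem_triSphere_iff.2 hy, hp⟩
  · obtain ⟨x, y, hx, hy, hp⟩ := hpath.symm.exists_arm_of_triNorm_le
      (triNorm_le_of_norm_triMeshPoint_le hδ hr₁ hN) (le_triNorm_of_le_norm_triMeshPoint hδ (hr₂.trans h0)) hr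
    exact ⟨x, mem_triSphere_iff.2 hx, y, mem_triSphere_iff.2 hy, hp⟩


/-! ### The alternating four-arm event from three traversals -/

/-- **Three shell traversals by interface loops force four alternating arms (cluster form).** Let
interface loops `w l` (`l : ι`, finite) of `ω` at mesh `δ` have pairwise disjoint traces and make, in
total, at least three separate crossings of the round shell `{ρ ≤ |z| ≤ R}` about the origin, given
by vertex indices `1 ≤ a l i < b l i < n_l` with `‖polyPt (a l i)‖ ≤ ρ`, `R ≤ ‖polyPt (b l i)‖` or
conversely, pairwise separated on each loop. If `0 < q₁`, `ρ + 2δ ≤ q₁`, `q₁ + 40δ ≤ q₂`,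
`q₂ + 2δ ≤ R`, then for all hexagonal radii `r₁ ≤ r₂` with `q₁ + 9δ ≤ (√3/2) δ r₁` and
`δ r₂ ≤ q₂ - 9δ`, **`ω ∈ altFourArm r₁ r₂`**: two open arms in distinct open clusters of the
annulus `{r₁ ≤ |·|_𝕋 ≤ r₂}` and two closed arms in distinct closed clusters of it. Proof: two
stretches of left (open) sites in distinct sectors of the shell minus the traces
(`exists_two_left_chains_of_vertices`); the same for the reversed loops, interface loops of `ωᶜ`
with the same traces (`IsSiteInterfaceLoop.reverse_compl`, `polyTrace_reverse`), gives two
stretches of closed sites in distinct sectors; each stretch contains an arm of the hexagonal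
annulus (`exists_arm_of_chain`); open and closed arms are disjoint, arms in distinct sectors are
disjoint, and an open (closed) path of the annulus joining two of them would be a connected set off
the traces joining two sectors (`PathIn.triMeshPoint_mem_connectedComponentIn`). This is the
lattice half ("if there are at least 4 interfaces, then also `𝒜₄` holds") of the identification
of the alternating four-arm event with interface crossings (Smirnov–Werner 2001, §4, Remark 6, even
`j`; Garban–Pete–Schramm 2013, §2.4). [cite: AizenmanBurchardDuke1999, Appendix A] [cite: SmirnovWernerMRL2001, §4 Remark 6] [cite: GarbanPeteSchramm2013Pivotal, §2.4 (proof of the measurability lemma, case A_2)] -/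
theorem mem_altFourArm_of_vertexTraversals {ω : SiteConfig (Site 2)} {δ : ℝ} (hδ : 0 < δ)
    {ρ R q₁ q₂ : ℝ} (hq₁ : 0 < q₁) (hρq : ρ + 2 * δ ≤ q₁) (hgap : q₁ + 40 * δ ≤ q₂) (hqR : q₂ + 2 * δ ≤ R)
    {ι : Type*} [Fintype ι] {f : ι → HexVertex} {w : ∀ l, hexGraph.Walk (f l) (f l)}
    (hw : ∀ l, IsSiteInterfaceLoop ω (w l))
    (hdis : ∀ l l', l ≠ l' → Disjoint (polyTrace δ (w l)) (polyTrace δ (w l')))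
    (k : ι → ℕ) (hk : 3 ≤ ∑ l, k l) (a b : ∀ l, Fin (k l) → ℕ)
    (ha : ∀ l i, 1 ≤ a l i) (hab : ∀ l i, a l i < b l i) (hb : ∀ l i, b l i < (w l).length)
    (hrad : ∀ l i, (‖polyPt δ (w l) (a l i)‖ ≤ ρ ∧ R ≤ ‖polyPt δ (w l) (b l i)‖) ∨
      (R ≤ ‖polyPt δ (w l) (a l i)‖ ∧ ‖polyPt δ (w l) (b l i)‖ ≤ ρ))
    (hsep : ∀ l (i j : Fin (k l)), i ≠ j → b l i < a l j ∨ b l j < a l i)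
    {r₁ r₂ : ℕ} (hr₁ : q₁ + 9 * δ ≤ Real.sqrt 3 / 2 * (δ * r₁)) (hr₂ : δ * r₂ ≤ q₂ - 9 * δ) (hr : r₁ ≤ r₂) :
    ω ∈ altFourArm r₁ r₂ := by
  classical
  set U : Set ℂ := {z | q₁ < dist z 0 ∧ dist z 0 < q₂} with hU
  set K : Set ℂ := ⋃ l₀, polyTrace δ (w l₀) with hKdef
  set Ann : Set (Site 2) := {v | (r₁ : ℤ) ≤ triNorm v ∧ triNorm v ≤ r₂} with hAnn
  have hAnn_eq : (triAnn r₁ r₂ : Set (Site 2)) = Ann := by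
    ext v; rw [mem_triAnn]; rfl
  -- radial hypotheses in `dist · 0` form
  have hrad' : ∀ l i, (dist (polyPt δ (w l) (a l i)) 0 ≤ ρ ∧ R ≤ dist (polyPt δ (w l) (b l i)) 0) ∨
      (R ≤ dist (polyPt δ (w l) (a l i)) 0 ∧ dist (polyPt δ (w l) (b l i)) 0 ≤ ρ) := by
    simpa only [dist_zero_right] using hrad
  /- the open side -/
  obtain ⟨l, l', k₀, k₁, k₀', k₁', hk₀₁, hk₁, hk₀₁', hk₁', hsepO, hballO, hballO', hendO, hendO'⟩ :=
    exists_two_left_chains_of_vertices hδ hq₁ hρq hgap hqR hw hdis k hk a b ha hab hb hrad' hsep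
  /- the closed side: the reversed loops are interface loops of `ωᶜ` with the same traces -/
  set w' : ∀ l, hexGraph.Walk (f l) (f l) := fun l ↦ (w l).reverse with hw'def
  have hw' : ∀ l, IsSiteInterfaceLoop ωᶜ (w' l) := fun l ↦ (hw l).reverse_compl
  have htr' : ∀ l, polyTrace δ (w' l) = polyTrace δ (w l) := fun l ↦ polyTrace_reverse δ (w l)
  have hlen' : ∀ l, (w' l).length = (w l).length := fun l ↦ SimpleGraph.Walk.length_reverse _
  have hdis' : ∀ l l', l ≠ l' → Disjoint (polyTrace δ (w' l)) (polyTrace δ (w' l')) := fun l l' h ↦ by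
    rw [htr', htr']; exact hdis l l' h
  have hK : (⋃ l₀, polyTrace δ (w' l₀)) = K := iUnion_congr htr'
  have hpt' : ∀ l (j : ℕ), j ≤ (w l).length → polyPt δ (w' l) ((w l).length - j) = polyPt δ (w l) j := by
    intro l j hj
    change polyPt δ (w l).reverse ((w l).length - j) = polyPt δ (w l) j
    rw [polyPt_reverse]
    congr 1
    omega
  obtain ⟨m, m', j₀, j₁, j₀', j₁', hj₀₁, hj₁, hj₀₁', hj₁', hsepC, hballC, hballC', hendC, hendC'⟩ :=
    exists_two_left_chains_of_vertices (ω := ωᶜ) hδ hq₁ hρq hgap hqR hw' hdis' k hk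
      (fun l i ↦ (w l).length - b l i) (fun l i ↦ (w l).length - a l i)
      (fun l i ↦ by have := hb l i; omega)
      (fun l i ↦ by have := hab l i; have := hb l i; omega)
      (fun l i ↦ by rw [hlen']; have := ha l i; have := hab l i; have := hb l i; omega)
      (fun l i ↦ by
        rw [hpt' l (b l i) (hb l i).le, hpt' l (a l i) ((hab l i).trans (hb l i)).le]
        rcases hrad' l i with ⟨h1, h2⟩ | ⟨h1, h2⟩
        · exact Or.inr ⟨h2, h1⟩
        · exact Or.inl ⟨h2, h1⟩)
      (fun l i j hij ↦ by
        have := hab l i; have := hab l j; have := hb l i; have := hb l j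
        rcases hsep l i j hij with h | h
        · right; omega
        · left; omega)
  rw [hK] at hsepC
  rw [hlen'] at hj₁ hj₁'
  /- the four chains -/
  set cO : ℕ → Site 2 := fun p ↦ (hw l).lv (k₀ + p) with hcO
  set cO' : ℕ → Site 2 := fun p ↦ (hw l').lv (k₀' + p) with hcO'
  set cC : ℕ → Site 2 := fun p ↦ (hw' m).lv (j₀ + p) with hcC
  set cC' : ℕ → Site 2 := fun p ↦ (hw' m').lv (j₀' + p) with hcC'
  have hstepO : ∀ p < k₁ - k₀, cO p = cO (p + 1) ∨ triGraph.Adj (cO p) (cO (p + 1)) := fun p hp ↦ by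
    rcases (hw l).lv_succ_eq_or_adj (i := k₀ + p) (by omega) with h | h
    exacts [Or.inl h.symm, Or.inr h]
  have hstepO' : ∀ p < k₁' - k₀', cO' p = cO' (p + 1) ∨ triGraph.Adj (cO' p) (cO' (p + 1)) := fun p hp ↦ by
    rcases (hw l').lv_succ_eq_or_adj (i := k₀' + p) (by omega) with h | h
    exacts [Or.inl h.symm, Or.inr h]
  have hstepC : ∀ p < j₁ - j₀, cC p = cC (p + 1) ∨ triGraph.Adj (cC p) (cC (p + 1)) := fun p hp ↦ by
    rcases (hw' m).lv_succ_eq_or_adj (i := j₀ + p) (by rw [hlen']; omega) with h | h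
    exacts [Or.inl h.symm, Or.inr h]
  have hstepC' : ∀ p < j₁' - j₀', cC' p = cC' (p + 1) ∨ triGraph.Adj (cC' p) (cC' (p + 1)) := fun p hp ↦ by
    rcases (hw' m').lv_succ_eq_or_adj (i := j₀' + p) (by rw [hlen']; omega) with h | h
    exacts [Or.inl h.symm, Or.inr h]
  -- ends, in norm form
  have hends_of : ∀ {ω₀ : SiteConfig (Site 2)} {g : HexVertex} {v : hexGraph.Walk g g} (hv : IsSiteInterfaceLoop ω₀ v)
      {i₀ i₁ : ℕ}, i₀ ≤ i₁ →
      ((dist (hv.leftPt δ i₀) 0 ≤ q₁ + 9 * δ ∧ q₂ - 9 * δ ≤ dist (hv.leftPt δ i₁) 0) ∨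
        (q₂ - 9 * δ ≤ dist (hv.leftPt δ i₀) 0 ∧ dist (hv.leftPt δ i₁) 0 ≤ q₁ + 9 * δ)) →
      ((‖triMeshPoint δ (hv.lv (i₀ + 0))‖ ≤ q₁ + 9 * δ ∧ q₂ - 9 * δ ≤ ‖triMeshPoint δ (hv.lv (i₀ + (i₁ - i₀)))‖) ∨
        (q₂ - 9 * δ ≤ ‖triMeshPoint δ (hv.lv (i₀ + 0))‖ ∧ ‖triMeshPoint δ (hv.lv (i₀ + (i₁ - i₀)))‖ ≤ q₁ + 9 * δ)) := by
    intro ω₀ g v hv i₀ i₁ hi h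
    have e : i₀ + (i₁ - i₀) = i₁ := by omega
    rw [add_zero, e]
    simpa only [dist_zero_right, IsSiteInterfaceLoop.leftPt] using h
  obtain ⟨x₀, hx₀, y₀, hy₀, hp₀⟩ := exists_arm_of_chain hδ hr₁ hr₂ hr cO (k₁ - k₀) hstepO (hends_of (hw l) hk₀₁ hendO)
  obtain ⟨x₂, hx₂, y₂, hy₂, hp₂⟩ := exists_arm_of_chain hδ hr₁ hr₂ hr cO' (k₁' - k₀') hstepO' (hends_of (hw l') hk₀₁' hendO')
  obtain ⟨x₁, hx₁, y₁, hy₁, hp₁⟩ := exists_arm_of_chain hδ hr₁ hr₂ hr cC (j₁ - j₀) hstepC (hends_of (hw' m) hj₀₁ hendC)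
  obtain ⟨x₃, hx₃, y₃, hy₃, hp₃⟩ := exists_arm_of_chain hδ hr₁ hr₂ hr cC' (j₁' - j₀') hstepC' (hends_of (hw' m') hj₀₁' hendC')
  /- the four site sets -/
  set T0 : Set (Site 2) := Ann ∩ {v | ∃ p ≤ k₁ - k₀, v = cO p} with hT0
  set T1 : Set (Site 2) := Ann ∩ {v | ∃ p ≤ j₁ - j₀, v = cC p} with hT1
  set T2 : Set (Site 2) := Ann ∩ {v | ∃ p ≤ k₁' - k₀', v = cO' p} with hT2
  set T3 : Set (Site 2) := Ann ∩ {v | ∃ p ≤ j₁' - j₀', v = cC' p} with hT3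
  -- colours
  have hcol0 : ∀ z ∈ T0, z ∈ ω := by
    rintro z ⟨-, p, hp, rfl⟩; exact (hw l).lv_mem (by omega)
  have hcol2 : ∀ z ∈ T2, z ∈ ω := by
    rintro z ⟨-, p, hp, rfl⟩; exact (hw l').lv_mem (by omega)
  have hcol1 : ∀ z ∈ T1, z ∉ ω := by
    rintro z ⟨-, p, hp, rfl⟩; exact (hw' m).lv_mem (by rw [hlen']; omega)
  have hcol3 : ∀ z ∈ T3, z ∉ ω := by
    rintro z ⟨-, p, hp, rfl⟩; exact (hw' m').lv_mem (by rw [hlen']; omega)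
  -- the discs of annulus sites are in the shell
  have hballAnn : ∀ z ∈ Ann, closedBall (triMeshPoint δ z) δ ⊆ U := fun z hz ↦
    closedBall_triMeshPoint_subset_shell hδ hr₁ hr₂ hz
  -- no open path of the annulus between `T0` and `T2`, no closed one between `T1` and `T3`
  have hsep₀₂ : ∀ u ∈ T0, ∀ u' ∈ T2, ¬ PathIn triGraph (triAnn r₁ r₂ ∩ ω) u u' := by
    rintro u ⟨-, p, hp, rfl⟩ u' ⟨-, p', hp', rfl⟩ hpath
    rw [hAnn_eq] at hpath
    have hmem := PathIn.triMeshPoint_mem_connectedComponentIn hδ hw (A := U) (S := Ann ∩ ω) inter_subset_right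
      (fun z hz ↦ hballAnn z hz.1) hpath
    exact hsepO (k₀ + p) (by omega) (by omega) (k₀' + p') (by omega) (by omega) hmem
  have hsep₁₃ : ∀ u ∈ T1, ∀ u' ∈ T3, ¬ PathIn triGraph (triAnn r₁ r₂ \ ω) u u' := by
    rintro u ⟨-, p, hp, rfl⟩ u' ⟨-, p', hp', rfl⟩ hpath
    rw [hAnn_eq] at hpath
    have hpath' : PathIn triGraph (Ann ∩ ωᶜ) ((hw' m).lv (j₀ + p)) ((hw' m').lv (j₀' + p')) :=
      hpath.mono fun z hz ↦ ⟨hz.1, hz.2⟩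
    have hmem := PathIn.triMeshPoint_mem_connectedComponentIn hδ hw' (A := U) (S := Ann ∩ ωᶜ) inter_subset_right
      (fun z hz ↦ hballAnn z hz.1) hpath'
    rw [hK] at hmem
    exact hsepC (j₀ + p) (by omega) (by omega) (j₀' + p') (by omega) (by omega) hmem
  -- disjointness
  have hself : ∀ {ω₀ : SiteConfig (Site 2)} {g : HexVertex} {v : hexGraph.Walk g g} (hv : IsSiteInterfaceLoop ω₀ v) (i : ℕ),
      closedBall (hv.leftPt δ i) δ ⊆ U → hv.leftPt δ i ∈ connectedComponentIn (U \ K) (hv.leftPt δ i) := by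
    intro ω₀ g v hv i hball
    refine mem_connectedComponentIn ⟨hball (mem_closedBall_self hδ.le), fun h ↦ ?_⟩
    obtain ⟨l₀, hl₀⟩ := mem_iUnion.1 h
    exact (hw l₀).triMeshPoint_not_mem_polyTrace hδ _ hl₀
  have d02 : Disjoint T0 T2 := by
    refine disjoint_left.2 ?_
    rintro z ⟨-, p, hp, rfl⟩ ⟨-, p', hp', he⟩
    refine hsepO (k₀ + p) (by omega) (by omega) (k₀' + p') (by omega) (by omega) ?_
    have he' : (hw l).lv (k₀ + p) = (hw l').lv (k₀' + p') := he
    have e : (hw l').leftPt δ (k₀' + p') = (hw l).leftPt δ (k₀ + p) := by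
      change triMeshPoint δ ((hw l').lv (k₀' + p')) = triMeshPoint δ ((hw l).lv (k₀ + p)); rw [he']
    rw [e]
    exact hself (hw l) (k₀ + p) (hballO (k₀ + p) (by omega) (by omega))
  have d13 : Disjoint T1 T3 := by
    refine disjoint_left.2 ?_
    rintro z ⟨-, p, hp, rfl⟩ ⟨-, p', hp', he⟩
    refine hsepC (j₀ + p) (by omega) (by omega) (j₀' + p') (by omega) (by omega) ?_
    have he' : (hw' m).lv (j₀ + p) = (hw' m').lv (j₀' + p') := he
    have e : (hw' m').leftPt δ (j₀' + p') = (hw' m).leftPt δ (j₀ + p) := by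
      change triMeshPoint δ ((hw' m').lv (j₀' + p')) = triMeshPoint δ ((hw' m).lv (j₀ + p)); rw [he']
    rw [e]
    exact hself (hw' m) (j₀ + p) (hballC (j₀ + p) (by omega) (by omega))
  have dOC : ∀ {A B : Set (Site 2)}, (∀ z ∈ A, z ∈ ω) → (∀ z ∈ B, z ∉ ω) → Disjoint A B :=
    fun hA hB ↦ disjoint_left.2 fun z hzA hzB ↦ hB z hzB (hA z hzA)
  have d01 : Disjoint T0 T1 := dOC hcol0 hcol1
  have d03 : Disjoint T0 T3 := dOC hcol0 hcol3
  have d21 : Disjoint T2 T1 := dOC hcol2 hcol1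
  have d23 : Disjoint T2 T3 := dOC hcol2 hcol3
  /- assemble -/
  refine mem_altFourArm_of_pathIn ![T0, T1, T2, T3] ?_ ?_ ?_ ?_ ?_ ?_
  · intro i j hij
    fin_cases i <;> fin_cases j
    all_goals first
      | exact absurd rfl hij
      | exact d01 | exact d01.symm | exact d02 | exact d02.symm | exact d03 | exact d03.symm
      | exact d21 | exact d21.symm | exact d13 | exact d13.symm | exact d23 | exact d23.symm
  · intro i z hz
    fin_cases i
    · change z ∈ T0 at hz; simp [hcol0 z hz]
    · change z ∈ T1 at hz; simp [hcol1 z hz]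
    · change z ∈ T2 at hz; simp [hcol2 z hz]
    · change z ∈ T3 at hz; simp [hcol3 z hz]
  · intro i z hz
    fin_cases i
    · change z ∈ T0 at hz; exact hz.1
    · change z ∈ T1 at hz; exact hz.1
    · change z ∈ T2 at hz; exact hz.1
    · change z ∈ T3 at hz; exact hz.1
  · intro i
    fin_cases i
    · exact ⟨x₀, hx₀, y₀, hy₀, hp₀⟩
    · exact ⟨x₁, hx₁, y₁, hy₁, hp₁⟩
    · exact ⟨x₂, hx₂, y₂, hy₂, hp₂⟩
    · exact ⟨x₃, hx₃, y₃, hy₃, hp₃⟩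
  · exact hsep₀₂
  · exact hsep₁₃


/-! ### From traversals in time to vertex indices -/

section TimeToVertex

variable {ω : SiteConfig (Site 2)} {f₀ : HexVertex} {w : hexGraph.Walk f₀ f₀}
  (hw : IsSiteInterfaceLoop ω w) {δ : ℝ} (hδ : 0 < δ)

include hw hδ

/-- The polygon at time `u` is within `2δ` of the far vertex `polyPt (polyIdx u + 1)` of its current
piece. [folklore] -/
theorem IsSiteInterfaceLoop.dist_polyPt_polyIdx_succ_le (u : I) :
    dist (hexLoopCurve δ w u) (polyPt δ w (polyIdx w.length u + 1)) ≤ 2 * δ := by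
  have hlen : 0 < w.length := by have := hw.three_le_length; omega
  have hp := polyIdx_lt hlen u
  have h1 : hexLoopCurve δ w u ∈ closedBall (hw.leftPt δ (polyIdx w.length u)) δ :=
    hw.polyPiece_subset_closedBall hδ.le hp (toCurve_mem_polyPiece (δ := δ) hlen u)
  have h2 := (hw.dist_polyPt_leftPt_le hδ.le hp).2
  rw [mem_closedBall] at h1
  linarith [dist_triangle (hexLoopCurve δ w u) (hw.leftPt δ (polyIdx w.length u)) (polyPt δ w (polyIdx w.length u + 1)),
    dist_comm (hw.leftPt δ (polyIdx w.length u)) (polyPt δ w (polyIdx w.length u + 1))]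

/-- The polygon at time `u` is within `3δ` of the vertex `polyPt (polyIdx u - 1)` before its
current piece (when there is one). [folklore] -/
theorem IsSiteInterfaceLoop.dist_polyPt_polyIdx_pred_le (u : I) (h1 : 1 ≤ polyIdx w.length u) :
    dist (hexLoopCurve δ w u) (polyPt δ w (polyIdx w.length u - 1)) ≤ 3 * δ := by
  have hlen : 0 < w.length := by have := hw.three_le_length; omega
  set p := polyIdx w.length u with hpdef
  have hp : p < w.length := polyIdx_lt hlen u
  have ha : hexLoopCurve δ w u ∈ closedBall (hw.leftPt δ p) δ :=
    hw.polyPiece_subset_closedBall hδ.le hp (toCurve_mem_polyPiece (δ := δ) hlen u)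
  have hb : dist (hw.leftPt δ (p - 1)) (hw.leftPt δ (p - 1 + 1)) ≤ δ := hw.dist_leftPt_succ_le hδ.le (by omega)
  have hc := (hw.dist_polyPt_leftPt_le hδ.le (i := p - 1) (by omega)).1
  have e : p - 1 + 1 = p := by omega
  rw [e] at hb
  rw [mem_closedBall] at ha
  linarith [dist_triangle (hexLoopCurve δ w u) (hw.leftPt δ p) (polyPt δ w (p - 1)),
    dist_triangle (hw.leftPt δ p) (hw.leftPt δ (p - 1)) (polyPt δ w (p - 1)),
    dist_comm (hw.leftPt δ (p - 1)) (hw.leftPt δ p), dist_comm (hw.leftPt δ (p - 1)) (polyPt δ w (p - 1))]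

/-- **A traversal spans at least three pieces**: along a traversal of `D(x; ρ, R)` with
`ρ + 4δ < R` the piece index increases by at least `3` (two points of pieces at most two apart are
within `4δ`). [folklore] -/
theorem IsSiteInterfaceLoop.polyIdx_add_three_le {x : ℂ} {ρ R : ℝ} (hρR : ρ + 4 * δ < R) {s t : I}
    (h : (hexLoopCurve δ w).IsTraversal x ρ R s t) :
    polyIdx w.length s + 3 ≤ polyIdx w.length t := by
  have hlen : 0 < w.length := by have := hw.three_le_length; omega
  have hst : polyIdx w.length s ≤ polyIdx w.length t := polyIdx_mono _ h.1
  by_contra hlt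
  push Not at hlt
  -- the two points are within `4δ`
  set ps := polyIdx w.length s with hps
  set pt := polyIdx w.length t with hpt
  have hs : hexLoopCurve δ w s ∈ closedBall (hw.leftPt δ ps) δ :=
    hw.polyPiece_subset_closedBall hδ.le (polyIdx_lt hlen s) (toCurve_mem_polyPiece (δ := δ) hlen s)
  have ht : hexLoopCurve δ w t ∈ closedBall (hw.leftPt δ pt) δ :=
    hw.polyPiece_subset_closedBall hδ.le (polyIdx_lt hlen t) (toCurve_mem_polyPiece (δ := δ) hlen t)
  rw [mem_closedBall] at hs ht
  have hchain : ∀ j, ps + j < w.length → j ≤ 2 → dist (hw.leftPt δ ps) (hw.leftPt δ (ps + j)) ≤ j * δ := by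
    intro j hj hj2
    induction j with
    | zero => simp
    | succ j ih =>
      have h1 := ih (by omega) (by omega)
      have h2 := hw.dist_leftPt_succ_le hδ.le (i := ps + j) (by omega)
      rw [show ps + (j + 1) = ps + j + 1 by omega]
      push_cast
      linarith [dist_triangle (hw.leftPt δ ps) (hw.leftPt δ (ps + j)) (hw.leftPt δ (ps + j + 1))]
  obtain ⟨j, hj2, hj⟩ : ∃ j, j ≤ 2 ∧ pt = ps + j := ⟨pt - ps, by omega, by omega⟩
  have hd : dist (hw.leftPt δ ps) (hw.leftPt δ pt) ≤ 2 * δ := by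
    rw [hj]
    have := hchain j (by rw [← hj]; exact polyIdx_lt hlen t) hj2
    have hj2' : (j : ℝ) ≤ 2 := by exact_mod_cast hj2
    nlinarith
  have hclose : dist (hexLoopCurve δ w s) (hexLoopCurve δ w t) ≤ 4 * δ := by
    linarith [dist_triangle (hexLoopCurve δ w s) (hw.leftPt δ ps) (hexLoopCurve δ w t),
      dist_triangle (hw.leftPt δ ps) (hw.leftPt δ pt) (hexLoopCurve δ w t), dist_comm (hw.leftPt δ pt) (hexLoopCurve δ w t)]
  -- but radially they are `R - ρ > 4δ` apart
  have hfar : R - ρ ≤ dist (hexLoopCurve δ w s) (hexLoopCurve δ w t) := by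
    rcases h.2 with ⟨h1, h2⟩ | ⟨h1, h2⟩
    · linarith [dist_triangle (hexLoopCurve δ w t) (hexLoopCurve δ w s) x, dist_comm (hexLoopCurve δ w t) (hexLoopCurve δ w s)]
    · linarith [dist_triangle (hexLoopCurve δ w s) (hexLoopCurve δ w t) x]
  linarith

end TimeToVertex

/-- **Three shell traversals in time force four alternating arms.** The form of
`mem_altFourArm_of_vertexTraversals` with the traversals of loop `l` given, as in the
Aizenman–Burchard tightness bound of the loop ensemble (`HasTraversals`), by `k l` separate segments
of its polygon traversing `D(0; ρ, R)`, `Σ k l ≥ 3`; the vertices used are the far end of the piece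
of the starting time and the vertex before the piece of the final time (`ρ + 5δ ≤ q₁`,
`q₂ + 5δ ≤ R`). [cite: AizenmanBurchardDuke1999, Appendix A] [cite: SmirnovWernerMRL2001, §4 Remark 6] -/
theorem mem_altFourArm_of_hasTraversals {ω : SiteConfig (Site 2)} {δ : ℝ} (hδ : 0 < δ)
    {ρ R q₁ q₂ : ℝ} (hq₁ : 0 < q₁) (hρq : ρ + 5 * δ ≤ q₁) (hgap : q₁ + 40 * δ ≤ q₂) (hqR : q₂ + 5 * δ ≤ R)
    {ι : Type*} [Fintype ι] {f : ι → HexVertex} {w : ∀ l, hexGraph.Walk (f l) (f l)}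
    (hw : ∀ l, IsSiteInterfaceLoop ω (w l))
    (hdis : ∀ l l', l ≠ l' → Disjoint (polyTrace δ (w l)) (polyTrace δ (w l')))
    (k : ι → ℕ) (hk : 3 ≤ ∑ l, k l) (htr : ∀ l, (hexLoopCurve δ (w l)).HasTraversals (k l) 0 ρ R)
    {r₁ r₂ : ℕ} (hr₁ : q₁ + 9 * δ ≤ Real.sqrt 3 / 2 * (δ * r₁)) (hr₂ : δ * r₂ ≤ q₂ - 9 * δ) (hr : r₁ ≤ r₂) :
    ω ∈ altFourArm r₁ r₂ := by
  choose s t hst hsep using htr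
  have hlen : ∀ l, 0 < (w l).length := fun l ↦ by have := (hw l).three_le_length; omega
  have h3 : ∀ l i, polyIdx (w l).length (s l i) + 3 ≤ polyIdx (w l).length (t l i) :=
    fun l i ↦ (hw l).polyIdx_add_three_le hδ (by linarith) (hst l i)
  refine mem_altFourArm_of_vertexTraversals hδ hq₁ (ρ := ρ + 3 * δ) (R := R - 3 * δ) (by linarith) hgap
    (by linarith) hw hdis k hk (fun l i ↦ polyIdx (w l).length (s l i) + 1)
    (fun l i ↦ polyIdx (w l).length (t l i) - 1) (fun l i ↦ by omega) (fun l i ↦ by have := h3 l i; omega)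
    (fun l i ↦ by have := polyIdx_lt (hlen l) (t l i); omega) (fun l i ↦ ?_) (fun l i j hij ↦ ?_) hr₁ hr₂ hr
  · have ha := (hw l).dist_polyPt_polyIdx_succ_le hδ (s l i)
    have hb := (hw l).dist_polyPt_polyIdx_pred_le hδ (t l i) (by have := h3 l i; omega)
    rw [dist_eq_norm] at ha hb
    have na := norm_sub_norm_le (hexLoopCurve δ (w l) (s l i)) (polyPt δ (w l) (polyIdx (w l).length (s l i) + 1))
    have na' := norm_sub_norm_le (polyPt δ (w l) (polyIdx (w l).length (s l i) + 1)) (hexLoopCurve δ (w l) (s l i))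
    have nb := norm_sub_norm_le (hexLoopCurve δ (w l) (t l i)) (polyPt δ (w l) (polyIdx (w l).length (t l i) - 1))
    have nb' := norm_sub_norm_le (polyPt δ (w l) (polyIdx (w l).length (t l i) - 1)) (hexLoopCurve δ (w l) (t l i))
    rw [norm_sub_rev] at na' nb'
    rcases (hst l i).2 with ⟨h1, h2⟩ | ⟨h1, h2⟩ <;> rw [dist_zero_right] at h1 h2
    · left; constructor <;> linarith
    · right; constructor <;> linarith
  · rcases lt_or_gt_of_ne hij with h | h
    · left
      have h1 : polyIdx (w l).length (t l i) ≤ polyIdx (w l).length (s l j) := polyIdx_mono _ (hsep l h).le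
      have := h3 l i
      omega
    · right
      have h1 : polyIdx (w l).length (t l j) ≤ polyIdx (w l).length (s l i) := polyIdx_mono _ (hsep l h).le
      have := h3 l j
      omega

/-- **One interface loop traversing a shell three times forces four alternating arms** (the case
of a single loop: three separate segments of its polygon traverse `D(0; ρ, R)`, e.g. a cluster
boundary making two round trips across the annulus). [cite: AizenmanBurchardDuke1999, Appendix A] [cite: SmirnovWernerMRL2001, §4 Remark 6] -/
theorem IsSiteInterfaceLoop.mem_altFourArm_of_hasTraversals_three {ω : SiteConfig (Site 2)} {f₀ : HexVertex}
    {w : hexGraph.Walk f₀ f₀} (hw : IsSiteInterfaceLoop ω w) {δ : ℝ} (hδ : 0 < δ)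
    {ρ R q₁ q₂ : ℝ} (hq₁ : 0 < q₁) (hρq : ρ + 5 * δ ≤ q₁) (hgap : q₁ + 40 * δ ≤ q₂) (hqR : q₂ + 5 * δ ≤ R)
    (htr : (hexLoopCurve δ w).HasTraversals 3 0 ρ R)
    {r₁ r₂ : ℕ} (hr₁ : q₁ + 9 * δ ≤ Real.sqrt 3 / 2 * (δ * r₁)) (hr₂ : δ * r₂ ≤ q₂ - 9 * δ) (hr : r₁ ≤ r₂) :
    ω ∈ altFourArm r₁ r₂ :=
  mem_altFourArm_of_hasTraversals hδ hq₁ hρq hgap hqR (ι := Unit) (f := fun _ ↦ f₀) (w := fun _ ↦ w)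
    (fun _ ↦ hw) (fun l l' h ↦ absurd (Subsingleton.elim l l') h) (fun _ ↦ 3) (by simp) (fun _ ↦ htr) hr₁ hr₂ hr

/-- **Two interface loops with disjoint traces traversing a shell three times in total force four
alternating arms** (e.g. two distinct cluster boundaries each crossing the annulus).
[cite: AizenmanBurchardDuke1999, Appendix A] [cite: SmirnovWernerMRL2001, §4 Remark 6] -/
theorem mem_altFourArm_of_hasTraversals_two {ω : SiteConfig (Site 2)} {f₁ f₂ : HexVertex}
    {w₁ : hexGraph.Walk f₁ f₁} {w₂ : hexGraph.Walk f₂ f₂} (hw₁ : IsSiteInterfaceLoop ω w₁) (hw₂ : IsSiteInterfaceLoop ω w₂)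
    {δ : ℝ} (hδ : 0 < δ) (hdis : Disjoint (polyTrace δ w₁) (polyTrace δ w₂))
    {ρ R q₁ q₂ : ℝ} (hq₁ : 0 < q₁) (hρq : ρ + 5 * δ ≤ q₁) (hgap : q₁ + 40 * δ ≤ q₂) (hqR : q₂ + 5 * δ ≤ R)
    {k₁ k₂ : ℕ} (hk : 3 ≤ k₁ + k₂) (h₁ : (hexLoopCurve δ w₁).HasTraversals k₁ 0 ρ R)
    (h₂ : (hexLoopCurve δ w₂).HasTraversals k₂ 0 ρ R)
    {r₁ r₂ : ℕ} (hr₁ : q₁ + 9 * δ ≤ Real.sqrt 3 / 2 * (δ * r₁)) (hr₂ : δ * r₂ ≤ q₂ - 9 * δ) (hr : r₁ ≤ r₂) :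
    ω ∈ altFourArm r₁ r₂ := by
  let f : Bool → HexVertex := fun c ↦ Bool.rec f₂ f₁ c
  let w : ∀ c, hexGraph.Walk (f c) (f c) := fun c ↦ Bool.rec (motive := fun c ↦ hexGraph.Walk (f c) (f c)) w₂ w₁ c
  have hw : ∀ c, IsSiteInterfaceLoop ω (w c) := fun c ↦ by cases c; exacts [hw₂, hw₁]
  refine mem_altFourArm_of_hasTraversals hδ hq₁ hρq hgap hqR (w := w) hw (fun c c' h ↦ ?_)
    (fun c ↦ Bool.rec k₂ k₁ c) (by simpa [add_comm] using hk) (fun c ↦ ?_) hr₁ hr₂ hr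
  · cases c <;> cases c'
    · exact absurd rfl h
    · exact hdis.symm
    · exact hdis
    · exact absurd rfl h
  · cases c; exacts [h₂, h₁]

end Literature.Probability.Percolation
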